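import Literature.AlgebraicGeometry.Morphisms.UpperSemicontinuityH0ZariskiLocal
import Literature.AlgebraicGeometry.Morphisms.SectionsRankOneIffGeometricallyConnected
import Literature.AlgebraicGeometry.Morphisms.FormalFunctionsModuleComplete
import Literature.AlgebraicGeometry.Morphisms.CechModuleUnit
import Literature.AlgebraicGeometry.Modules.ExtensionContraction
import Literature.AlgebraicGeometry.Motives.VarietiesGeometricallyIntegralProofs
import Mathlib.Algebra.Category.ModuleCat.Sheaf.PullbackFree
import HarnessLib

/-!
# The geometrically-connected-fibre locus of a proper flat morphism with geometrically reduced fibres is open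
# (EGA IV₃ 12.2.4; Mumford, *Abelian Varieties*, §5 Cor. 1; MFK Prop. 7.3 step (I))

Topic `Literature/AlgebraicGeometry/Morphisms`; theorems only (no definition, no named fact, no instance, no notation, no
`sorry`).  Cell hodgecm-mathlib, F-DAG F-6 (I) brick U4 — the ASSEMBLY of the F-6 (I) chain (census
`B-provers/B-p15/g12/CENSUS-F6I-GeomConnectedOpen.B-p15g12.md`): ★ U1 `Modules/ProperFlatH0KernelRepr` → ★ U2
`Morphisms/UpperSemicontinuityH0` → ★ U2b `Morphisms/UpperSemicontinuityH0ZariskiLocal` (upper semicontinuity of `h⁰` over any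
locally noetherian base) and ★ U3 `Morphisms/SectionsRankOneIffGeometricallyConnected` (B-p13 (g19): `h⁰ = 1 ⟺` geometrically
connected, for proper geometrically reduced schemes over a field).  Consumer: F-6 (I) = [MumfordFogartyKirwan1994] Prop. 7.3,
step (I) «the set of points of the Hilbert scheme where the fibre is smooth and connected is open» (with ★
`Morphisms/OpenSmoothFibreLocus.isOpen_setOf_smooth_fiber`).  HC_CM is proved only modulo the 7 printed citations until rung 0
closes; nothing here bears on a summit statement.

For `p : X ⟶ S` and `s ∈ S` the chain's `h⁰(s)` is
`finrank_{Γ(Spec κ(s), 𝒪)} (SecMod ((p.fiberι s)^* 𝒪_X) (p.fiberToSpecResidueField s)♯ ⊤)` (★ `Modules.SecMod`, `𝒪_X = unitModule X`).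

* §1 bridges over a field `K`, `f : Y ⟶ Spec K`: `nonempty_pullback_unitModule_iso` (`g^*𝒪_X ≅ 𝒪_Y`, Mathlib
  `SheafOfModules.pullbackObjUnitToUnit` + ★ `final_opensMap`), `finrank_secMod_unitModule_eq_finrank_sections`
  (`SecMod 𝒪_Y f♯ ⊤` has the rank of `Γ(Y, 𝒪)` as `Γ(Spec K, 𝒪)`-module through `f.appTop`),
  `module_finite_sections_of_isProper` (`Γ(Y, 𝒪)` is finite over `K` for `Y` proper — ★ `moduleFinite_msections_of_coh`),
  `finrank_sections_pos_of_isProper` (`0 < dim_K Γ(Y, 𝒪)` when `Y ≠ ∅`);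
* §2 the fibre of `p` at `s`: `finrank_secMod_fiber_unitModule_eq_finrank_sections`, **`finrank_secMod_fiber_unitModule_eq_one_iff`**
  (`h⁰(s) = 1 ⟺ p.fiber s → Spec κ(s)` geometrically connected, for `p` universally closed quasi-separated with geometrically
  reduced fibre at `s` — ★ U3), `geometricallyConnected_of_finrank_secMod_fiber_unitModule_eq_one` (no reducedness),
  `one_le_finrank_secMod_fiber_unitModule` (`1 ≤ h⁰(s)` on the image of a proper `p`);
* §3 **`isOpen_setOf_geometricallyConnected_fiber`**: for `p` proper and flat over a locally noetherian `S` with geometrically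
  reduced fibres, `{s | GeometricallyConnected (p.fiberToSpecResidueField s)}` `= {s | h⁰(s) < 2} ∩ p(X)` is OPEN (★ U2b + Mathlib
  `UniversallyOpen.of_flat`); **`isOpen_setOf_geometricallyConnected_fiber_of_smooth`** (smooth proper `p`: fibres are
  geometrically reduced by ★ `Motives.geometricallyReduced_of_smooth`) — the F-6 (I) shape.

## References
* A. Grothendieck, EGA IV₃ (Publ. Math. IHÉS 28, 1966), Thm. 12.2.4. [EGAIV3]
* D. Mumford, *Abelian Varieties*, TIFR Studies in Mathematics 5 (1970), §5, Cor. 1 (p. 50). [MumfordAV1970]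
* D. Mumford, J. Fogarty, F. Kirwan, *Geometric Invariant Theory*, 3rd ed. (1994), Ch. 7 §2, Prop. 7.3, proof, step (I)
  (pp. 132–133). [MumfordFogartyKirwan1994]
* The Stacks Project, Tag 04KV, Tag 056T. [StacksProject]
* R. Hartshorne, *Algebraic Geometry*, GTM 52 (1977), II §5 p. 110 (`f^*𝒪_Y = 𝒪_X`), III Thm. 12.8 (p. 288). [Hartshorne1977]
-/

noncomputable section

set_option backward.isDefEq.respectTransparency false

open CategoryTheory CategoryTheory.Limits Opposite TopologicalSpace AlgebraicGeometry TensorProduct Module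

universe u

namespace Literature.AlgebraicGeometry.Morphisms

open Literature.AlgebraicGeometry.Modules Literature.AlgebraicGeometry.KTheory

/-! ## §1 Bridges over a field: `g^*𝒪 ≅ 𝒪`, the scalars `Γ(Spec K, 𝒪)`, finiteness of `Γ(Y, 𝒪)` -/

section Field

/-- **`g^*𝒪_X ≅ 𝒪_Y`** for any morphism of schemes `g : Y → X` (Mathlib's comparison `SheafOfModules.pullbackObjUnitToUnit`
is an isomorphism because `U ↦ g⁻¹U` is final, ★ `KTheory/PullbackVectorBundle.final_opensMap`; the tree's
`pullbackUnitModuleIso` is the `Over (Spec k)` instance of the same). [cite: Hartshorne1977, II §5 p. 110 (f^*𝒪_Y = 𝒪_X)] -/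
theorem nonempty_pullback_unitModule_iso {Y X : Scheme.{u}} (g : Y ⟶ X) :
    Nonempty ((Scheme.Modules.pullback g).obj (unitModule X) ≅ unitModule Y) := by
  have hI : IsIso (SheafOfModules.pullbackObjUnitToUnit g.toRingCatSheafHom) := by
    haveI := final_opensMap g
    infer_instance
  exact ⟨@asIso _ _ _ _ (SheafOfModules.pullbackObjUnitToUnit g.toRingCatSheafHom) hI⟩

variable {K : Type u} [Field K] {Y : Scheme.{u}} (f : Y ⟶ Spec (.of K))

/-- **The chain's scalars agree with ★ U3's**: `SecMod 𝒪_Y f♯ ⊤` (the `Γ(Spec K, 𝒪)`-module structure of ★ `Modules.SecMod`,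
`r • y = f♯(r)|_⊤ · y`) has the same rank as `Γ(Y, 𝒪)` with the `Γ(Spec K, 𝒪)`-module structure through `f.appTop`
(the two structures differ by the restriction along `𝟙_⊤`). [cite: MumfordAV1970, §5 Cor. 1 (p. 50)] -/
theorem finrank_secMod_unitModule_eq_finrank_sections :
    finrank Γ(Spec (.of K), ⊤) (SecMod (unitModule Y) f.appTop.hom ⊤) =
      letI := f.appTop.hom.toAlgebra
      finrank Γ(Spec (.of K), ⊤) Γ(Y, ⊤) := by
  letI := f.appTop.hom.toAlgebra
  have ht : ∀ r : Γ(Spec (.of K), ⊤), (toSections f.appTop.hom ⊤ r : Γ(Y, ⊤)) = f.appTop.hom r := fun r => by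
    change Y.presheaf.map (homOfLE le_top).op (f.appTop r) = f.appTop r
    rw [show (homOfLE (le_top : (⊤ : Y.Opens) ≤ ⊤)) = 𝟙 _ from Subsingleton.elim _ _, op_id, Y.presheaf.map_id]
    rfl
  have h := rank_eq_of_equiv_equiv (R := Γ(Spec (.of K), ⊤)) (R' := Γ(Spec (.of K), ⊤))
    (M := SecMod (unitModule Y) f.appTop.hom ⊤) (M₁ := Γ(Y, ⊤)) id
    (AddEquiv.refl Γ(Y, ⊤) : SecMod (unitModule Y) f.appTop.hom ⊤ ≃+ Γ(Y, ⊤)) Function.bijective_id (fun r m => by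
      change toSections f.appTop.hom ⊤ r * (show Γ(Y, ⊤) from m) = f.appTop.hom r * (show Γ(Y, ⊤) from m)
      rw [ht])
  exact congrArg Cardinal.toNat h

/-- **`Γ(Y, 𝒪_Y)` is a finite-dimensional `K`-vector space for `Y → Spec K` proper** (★ `moduleFinite_msections_of_coh` for the
coherent `𝒪_Y`, transported from the tree's `MSections`/`Sections` structure — which restricts along `𝟙_⊤` — to the
`K`-algebra structure `f.appTop ∘ (ΓSpecIso K)⁻¹` of ★ U3). [cite: MumfordAV1970, §5 Cor. 1 (p. 50)] -/
theorem module_finite_sections_of_isProper [IsProper f] :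
    letI := (f.appTop.hom.comp (Scheme.ΓSpecIso (.of K)).inv.hom).toAlgebra
    Module.Finite K Γ(Y, ⊤) := by
  have h : Module.Finite K (MSections f (unitModule Y) ⊤) :=
    moduleFinite_msections_of_coh f (coh_of_isVectorBundle isFiniteLocallyFree_unitModule.isVectorBundle)
  letI := (f.appTop.hom.comp (Scheme.ΓSpecIso (.of K)).inv.hom).toAlgebra
  let L : MSections f (unitModule Y) ⊤ →ₗ[K] Γ(Y, ⊤) :=
    { toFun := fun m => (show Γ(Y, ⊤) from m), map_add' := fun _ _ => rfl, map_smul' := fun a m => ?_ }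
  · exact Module.Finite.of_surjective L (fun m => ⟨m, rfl⟩)
  change (show Γ(Y, ⊤) from algebraMap K (Sections f ⊤) a) * (show Γ(Y, ⊤) from m) =
    algebraMapΓ f a * (show Γ(Y, ⊤) from m)
  congr 1
  rw [Sections.algebraMap_apply]
  change Y.presheaf.map (homOfLE le_top).op (algebraMapΓ f a) = _
  rw [show (homOfLE (le_top : (⊤ : Y.Opens) ≤ ⊤)) = 𝟙 _ from Subsingleton.elim _ _, op_id, Y.presheaf.map_id]
  rfl

/-- **`0 < dim_K Γ(Y, 𝒪_Y)` for `Y → Spec K` proper and non-empty** (`Γ(Y, 𝒪)` is finite over `K` and a nonzero ring).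
[cite: MumfordAV1970, §5 Cor. 1 (p. 50)] -/
theorem finrank_sections_pos_of_isProper [IsProper f] [Nonempty Y] :
    letI := (f.appTop.hom.comp (Scheme.ΓSpecIso (.of K)).inv.hom).toAlgebra
    0 < finrank K Γ(Y, ⊤) := by
  letI := (f.appTop.hom.comp (Scheme.ΓSpecIso (.of K)).inv.hom).toAlgebra
  haveI := module_finite_sections_of_isProper f
  haveI : Nontrivial Γ(Y, ⊤) := (Y.presheaf.germ ⊤ (Classical.arbitrary Y) trivial).hom.domain_nontrivial
  exact Module.finrank_pos

end Field

/-! ## §2 The fibre of `p : X → S` at `s`: `h⁰(s) = 1 ⟺` geometrically connected -/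

section Fibre

variable {X S : Scheme.{u}} (p : X ⟶ S) (s : S)

/-- The chain's `h⁰(s)` (sections of `(p.fiberι s)^*𝒪_X`) is the rank of `Γ(p.fiber s, 𝒪)` over `Γ(Spec κ(s), 𝒪)` through
`(p.fiberToSpecResidueField s).appTop` — ★ U3's scalars (§1 along `(p.fiberι s)^*𝒪_X ≅ 𝒪_{p.fiber s}`).
[cite: MumfordAV1970, §5 Cor. 1 (p. 50)] [cite: Hartshorne1977, II §5 p. 110 (f^*𝒪_Y = 𝒪_X)] -/
theorem finrank_secMod_fiber_unitModule_eq_finrank_sections :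
    finrank Γ(Spec (S.residueField s), ⊤)
        (SecMod ((Scheme.Modules.pullback (p.fiberι s)).obj (unitModule X)) (p.fiberToSpecResidueField s).appTop.hom ⊤) =
      letI := (p.fiberToSpecResidueField s).appTop.hom.toAlgebra
      finrank Γ(Spec (S.residueField s), ⊤) Γ(p.fiber s, ⊤) := by
  obtain ⟨e⟩ := nonempty_pullback_unitModule_iso (p.fiberι s)
  rw [finrank_secMod_eq_of_iso (p.fiberToSpecResidueField s).appTop.hom e]
  exact finrank_secMod_unitModule_eq_finrank_sections (K := S.residueField s) (p.fiberToSpecResidueField s)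

/-- **`h⁰(s) = 1 ⟺ the fibre at `s` is geometrically connected**, for `p` universally closed and quasi-separated with
geometrically reduced fibre at `s` (★ U3 `finrank_sections_fiber_appTop_eq_one_iff_geometricallyConnected`, B-p13 (g19)).
[cite: StacksProject, Tag 04KV] [cite: EGAIV3, Thm. 12.2.4] -/
theorem finrank_secMod_fiber_unitModule_eq_one_iff [UniversallyClosed p] [QuasiSeparated p]
    [GeometricallyReduced (p.fiberToSpecResidueField s)] :
    finrank Γ(Spec (S.residueField s), ⊤)
        (SecMod ((Scheme.Modules.pullback (p.fiberι s)).obj (unitModule X)) (p.fiberToSpecResidueField s).appTop.hom ⊤) = 1 ↔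
      GeometricallyConnected (p.fiberToSpecResidueField s) := by
  rw [finrank_secMod_fiber_unitModule_eq_finrank_sections]
  exact finrank_sections_fiber_appTop_eq_one_iff_geometricallyConnected p s

/-- **`h⁰(s) = 1 ⇒` the fibre at `s` is geometrically connected** — no reducedness, no properness (`p` quasi-compact and
quasi-separated; ★ U3 `geometricallyConnected_of_finrank_appTop_eq_one`). [cite: StacksProject, Tag 04KV] -/
theorem geometricallyConnected_of_finrank_secMod_fiber_unitModule_eq_one [QuasiCompact p] [QuasiSeparated p]
    (h1 : finrank Γ(Spec (S.residueField s), ⊤)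
        (SecMod ((Scheme.Modules.pullback (p.fiberι s)).obj (unitModule X)) (p.fiberToSpecResidueField s).appTop.hom ⊤) = 1) :
    GeometricallyConnected (p.fiberToSpecResidueField s) := by
  haveI : QuasiCompact (p.fiberToSpecResidueField s) := MorphismProperty.pullback_snd _ _ inferInstance
  haveI : QuasiSeparated (p.fiberToSpecResidueField s) := MorphismProperty.pullback_snd _ _ inferInstance
  haveI : QuasiSeparatedSpace (p.fiber s) := quasiSeparatedSpace_of_quasiSeparated (p.fiberToSpecResidueField s)
  rw [finrank_secMod_fiber_unitModule_eq_finrank_sections] at h1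
  refine geometricallyConnected_of_finrank_appTop_eq_one (k := S.residueField s) (p.fiberToSpecResidueField s) ?_
  rw [← finrank_sections_appTop_eq_finrank (k := S.residueField s) (p.fiberToSpecResidueField s)]
  exact h1

/-- **`1 ≤ h⁰(s)` at every point of the image of a proper `p`** (the fibre is a non-empty proper `κ(s)`-scheme, so `Γ(𝒪)` is a
nonzero finite-dimensional `κ(s)`-vector space). [cite: MumfordAV1970, §5 Cor. 1 (p. 50)] -/
theorem one_le_finrank_secMod_fiber_unitModule [IsProper p] (hs : s ∈ Set.range p.base) :
    1 ≤ finrank Γ(Spec (S.residueField s), ⊤)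
        (SecMod ((Scheme.Modules.pullback (p.fiberι s)).obj (unitModule X)) (p.fiberToSpecResidueField s).appTop.hom ⊤) := by
  haveI : IsProper (p.fiberToSpecResidueField s) := MorphismProperty.pullback_snd _ _ inferInstance
  haveI : Nonempty (p.fiber s) := by
    obtain ⟨x, hx⟩ := hs
    have hx' : x ∈ Set.range (p.fiberι s).base := by rw [Scheme.Hom.range_fiberι]; exact hx
    obtain ⟨z, -⟩ := hx'
    exact ⟨z⟩
  rw [finrank_secMod_fiber_unitModule_eq_finrank_sections]
  have h := finrank_sections_pos_of_isProper (K := S.residueField s) (p.fiberToSpecResidueField s)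
  have e := finrank_sections_appTop_eq_finrank (k := S.residueField s) (p.fiberToSpecResidueField s)
  have key : letI := (p.fiberToSpecResidueField s).appTop.hom.toAlgebra
      1 ≤ finrank Γ(Spec (.of (S.residueField s)), ⊤) Γ(p.fiber s, ⊤) := by
    rw [e]
    exact h
  exact key

end Fibre

/-! ## §3 The geometrically-connected-fibre locus is open -/

section Locus

variable {X S : Scheme.{0}} (p : X ⟶ S) [IsProper p] [Flat p] [IsLocallyNoetherian S]

/-- **THE GEOMETRICALLY-CONNECTED-FIBRE LOCUS IS OPEN**: for `p : X → S` proper and flat over a locally noetherian `S` whose fibres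
are geometrically reduced, `{s ∈ S | p.fiber s → Spec κ(s) is geometrically connected}` is open — it is
`{s | h⁰(s) < 2} ∩ p(X)`, open by upper semicontinuity of `h⁰` (★ U2b `isOpen_setOf_finrank_secMod_fiber_lt_of_isLocallyNoetherian`
for `𝒪_X`) and openness of the flat finitely presented `p` (Mathlib `UniversallyOpen.of_flat`), and it is the locus by §2
(`h⁰ = 1 ⟺` geometrically connected on geometrically reduced proper fibres; `1 ≤ h⁰` on `p(X)`; geometrically connected fibres
are non-empty). [cite: EGAIV3, Thm. 12.2.4] [cite: MumfordAV1970, §5 Cor. 1 (p. 50)]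
[cite: MumfordFogartyKirwan1994, Ch. 7 §2, Prop. 7.3, proof, step (I) (pp. 132–133)] -/
theorem isOpen_setOf_geometricallyConnected_fiber (hred : ∀ s : S, GeometricallyReduced (p.fiberToSpecResidueField s)) :
    IsOpen {s : S | GeometricallyConnected (p.fiberToSpecResidueField s)} := by
  have hU := isOpen_setOf_finrank_secMod_fiber_lt_of_isLocallyNoetherian p (unitModule X) isFiniteLocallyFree_unitModule 2
  have hV : IsOpen (Set.range p.base) := p.isOpenMap.isOpen_range
  convert hU.inter hV using 1
  ext s
  simp only [Set.mem_setOf_eq, Set.mem_inter_iff]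
  constructor
  · intro h
    haveI := h
    haveI := hred s
    refine ⟨?_, ?_⟩
    · rw [(finrank_secMod_fiber_unitModule_eq_one_iff p s).2 h]
      exact Nat.lt_succ_self 1
    · -- a geometrically connected fibre is non-empty
      haveI : ConnectedSpace (p.fiber s) := by
        haveI : GeometricallyConnected (p.fiberToSpecResidueField s) := h
        exact GeometricallyConnected.connectedSpace_of_subsingleton (p.fiberToSpecResidueField s)
      obtain ⟨z⟩ := (inferInstance : Nonempty (p.fiber s))
      refine ⟨(p.fiberι s).base z, ?_⟩
      have hz : (p.fiberι s).base z ∈ Set.range (p.fiberι s).base := ⟨z, rfl⟩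
      rw [Scheme.Hom.range_fiberι] at hz
      exact hz
  · rintro ⟨hlt, hs⟩
    haveI := hred s
    have h1 := one_le_finrank_secMod_fiber_unitModule p s hs
    exact (finrank_secMod_fiber_unitModule_eq_one_iff p s).1 (by omega)

/-- **F-6 (I) shape — smooth proper families**: for `p : X → S` smooth and proper over a locally noetherian `S`, the set of
`s ∈ S` with geometrically connected fibre is open (fibres of a smooth morphism are smooth over `κ(s)`, hence geometrically
reduced — ★ `Motives.geometricallyReduced_of_smooth`, Stacks 056T). [cite: MumfordFogartyKirwan1994, Ch. 7 §2, Prop. 7.3, proof, step (I) (pp. 132–133)]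
[cite: StacksProject, Tag 056T] [cite: EGAIV3, Thm. 12.2.4] -/
theorem isOpen_setOf_geometricallyConnected_fiber_of_smooth [Smooth p] :
    IsOpen {s : S | GeometricallyConnected (p.fiberToSpecResidueField s)} := by
  refine isOpen_setOf_geometricallyConnected_fiber p fun s => ?_
  haveI : Smooth (p.fiberToSpecResidueField s) := MorphismProperty.pullback_snd _ _ inferInstance
  exact Literature.AlgebraicGeometry.Motives.geometricallyReduced_of_smooth (K := S.residueField s)
    (p.fiberToSpecResidueField s)

end Locus

end Literature.AlgebraicGeometry.Morphisms

end
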